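import Mathlib.RingTheory.Localization.Finiteness
import Mathlib.RingTheory.Localization.AtPrime.Basic
import Mathlib.RingTheory.Nakayama
import Mathlib.RingTheory.Finiteness.Cardinality
import HarnessLib

/-!
# Nakayama at a prime, elementwise, and torsion-free modules that are cyclic at a prime

Topic `Literature/RingTheory/RegularLocalRing`. Two elementary tools for the algebraisation step
of Grothendieck's parafactoriality theorem for hypersurfaces (SGA 2 XI 3.13 (ii); the complete
case `hC` of `Grothendieck1968_samuelConjecture_hypersurface`): the finitely generated module of
formal sections `L` is torsion-free and cyclic at every non-maximal prime of `V(t)`, and one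
wants to realise it as an ideal of the (factorial) base ring.

* `exists_smul_eq_smul_of_forall_add` — **Nakayama at a prime, elementwise**: if every `x ∈ L`
  satisfies `u x ∈ S ℓ₀ + t L` for some `u ∉ Q` (`t ∈ Q`, `L` finite), then every `x`
  satisfies `u x ∈ S ℓ₀` for some `u ∉ Q` (Nakayama for `L_Q` over `S_Q`, Mathlib's
  `Submodule.le_of_le_smul_of_le_jacobson_bot`).
* `exists_linearMap_injective_of_forall_smul_eq_smul` — a finite torsion-free module over a domain
  which is cyclic at one prime embeds linearly into the ring (so is isomorphic to an ideal,
  `exists_ideal_linearEquiv_of_forall_smul_eq_smul`).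

Everything is proved; no named facts.

## References

* [Grothendieck1968SGA2] A. Grothendieck, SGA 2, Exp. IX §2 (existence), Exp. XI Thm. 3.13 (ii)
  (arXiv:math/0511279).
* [Matsumura1987] H. Matsumura, *Commutative Ring Theory*, Thm. 2.2 (Nakayama), §4.
-/

noncomputable section

universe u v

namespace Literature.RingTheory.RegularLocalRing

open IsLocalRing

/-! ## Nakayama at a prime, elementwise -/

/-- **Nakayama at a prime, elementwise.** Let `Q` be a prime of `S`, `t ∈ Q`, `L` a finite
`S`-module and `ℓ₀ ∈ L`. If every `x ∈ L` satisfies `u • x = a • ℓ₀ + t • w` for some `u ∉ Q`,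
then every `x` satisfies `u • x = a • ℓ₀` for some `u ∉ Q` (i.e. `L_Q = S_Q ℓ₀`).
[cite: Matsumura1987, Thm. 2.2] -/
theorem exists_smul_eq_smul_of_forall_add {S : Type u} [CommRing S] (Q : Ideal S) [Q.IsPrime]
    {t : S} (ht : t ∈ Q) {L : Type v} [AddCommGroup L] [Module S L] [Module.Finite S L] (ℓ₀ : L)
    (h : ∀ x : L, ∃ u ∉ Q, ∃ (a : S) (w : L), u • x = a • ℓ₀ + t • w) (x : L) :
    ∃ u ∉ Q, ∃ a : S, u • x = a • ℓ₀ := by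
  set SQ := Localization.AtPrime Q with hSQ
  set LQ := LocalizedModule Q.primeCompl L with hLQ
  set g : LQ := LocalizedModule.mk ℓ₀ 1 with hg
  set N : Submodule SQ LQ := SQ ∙ g with hN
  set mk₁ : L →ₗ[S] LQ := LocalizedModule.mkLinearMap Q.primeCompl L with hmk₁
  have hmk₁_apply : ∀ m : L, mk₁ m = LocalizedModule.mk m 1 := fun m => rfl
  -- `LQ ⊆ N + 𝔪_Q LQ`
  have hle : (⊤ : Submodule SQ LQ) ≤ N ⊔ (maximalIdeal SQ) • ⊤ := by
    intro z _
    induction z using LocalizedModule.induction_on with | h m s => ?_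
    obtain ⟨u, hu, a, w, hm⟩ := h m
    have hus : IsUnit (algebraMap S SQ u) := IsLocalization.map_units SQ (⟨u, hu⟩ : Q.primeCompl)
    -- `u • (m/1) = a • g + t • (w/1)`
    have h1 : algebraMap S SQ u • mk₁ m = algebraMap S SQ a • g + algebraMap S SQ t • mk₁ w := by
      rw [algebraMap_smul, algebraMap_smul, algebraMap_smul, ← LinearMap.map_smul, hm, map_add,
        LinearMap.map_smul, LinearMap.map_smul]
      rfl
    have h2 : mk₁ m ∈ N ⊔ (maximalIdeal SQ) • ⊤ := by
      have h3 : mk₁ m = (hus.unit⁻¹ : SQˣ) • (algebraMap S SQ a • g + algebraMap S SQ t • mk₁ w) := by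
        rw [← h1, Units.smul_def, ← mul_smul, IsUnit.val_inv_mul, one_smul]
      rw [h3, smul_add, Units.smul_def, Units.smul_def, ← mul_smul, ← mul_smul]
      refine Submodule.add_mem_sup (Submodule.smul_mem _ _ (Submodule.mem_span_singleton_self g))
        (Submodule.smul_mem_smul ?_ Submodule.mem_top)
      exact Ideal.mul_mem_left _ _
        ((IsLocalization.AtPrime.to_map_mem_maximal_iff SQ Q t).mpr ht)
    -- `m/s = (1/s) • (m/1)`
    have h4 : (LocalizedModule.mk m s : LQ) = Localization.mk (1 : S) s • mk₁ m := by
      rw [hmk₁_apply, LocalizedModule.mk_smul_mk, one_smul, mul_one]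
    rw [h4]
    exact Submodule.smul_mem _ _ h2
  have htop : (⊤ : Submodule SQ LQ) ≤ N :=
    Submodule.le_of_le_smul_of_le_jacobson_bot Module.Finite.fg_top
      (IsLocalRing.maximalIdeal_le_jacobson _) hle
  -- read off the statement for `x`
  obtain ⟨c, hc⟩ := Submodule.mem_span_singleton.mp (htop (Submodule.mem_top (x := mk₁ x)))
  induction c using Localization.induction_on with | H p => ?_
  obtain ⟨a, u⟩ := p
  rw [hg, LocalizedModule.mk_smul_mk, hmk₁_apply, LocalizedModule.mk_eq] at hc
  obtain ⟨v, hv⟩ := hc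
  refine ⟨(v : S) * u, Q.primeCompl.mul_mem v.2 u.2, (v : S) * a, ?_⟩
  simp only [Submonoid.smul_def, mul_one, one_smul] at hv
  rw [mul_smul, mul_smul, ← hv]

/-! ## Torsion-free modules cyclic at a prime embed into the ring -/

/-- **A finite torsion-free module which is cyclic at a prime embeds into the ring.** Let `S`
be a domain, `Q` a prime, `L` a finite torsion-free `S`-module and `0 ≠ ℓ₀ ∈ L` such that
every `x ∈ L` satisfies `u • x = a • ℓ₀` for some `u ∉ Q` (i.e. `L_Q = S_Q ℓ₀`). Then there is
an injective `S`-linear map `L → S`: with `U := ∏ u_{g}` over a finite generating set, `U • x`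
is a well-defined multiple `b(x) • ℓ₀` for every `x`, and `x ↦ b(x)` works. [folklore] -/
theorem exists_linearMap_injective_of_forall_smul_eq_smul {S : Type u} [CommRing S] [IsDomain S]
    (Q : Ideal S) [Q.IsPrime] {L : Type v} [AddCommGroup L] [Module S L] [Module.Finite S L]
    [NoZeroSMulDivisors S L] {ℓ₀ : L} (hℓ₀ : ℓ₀ ≠ 0)
    (h : ∀ x : L, ∃ u ∉ Q, ∃ a : S, u • x = a • ℓ₀) :
    ∃ χ : L →ₗ[S] S, Function.Injective χ := by
  classical
  obtain ⟨G, hG⟩ := Module.Finite.fg_top (R := S) (M := L)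
  choose u hu a ha using h
  set U : S := ∏ g ∈ G, u g with hUdef
  have hU : U ∉ Q := by
    have : U ∈ Q.primeCompl := prod_mem (S := Q.primeCompl) fun g _ => hu g
    exact this
  have hU0 : U ≠ 0 := fun h0 => hU (h0 ▸ Q.zero_mem)
  -- `U • x ∈ S ℓ₀` for every `x`
  have key : ∀ x : L, ∃ b : S, U • x = b • ℓ₀ := by
    intro x
    have hx : x ∈ Submodule.span S (G : Set L) := hG ▸ Submodule.mem_top
    induction hx using Submodule.span_induction with
    | mem g hg =>
      refine ⟨(∏ g' ∈ G.erase g, u g') * a g, ?_⟩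
      rw [hUdef, ← Finset.mul_prod_erase G u hg, mul_comm (u g), mul_smul, ha g, ← mul_smul]
    | zero => exact ⟨0, by simp⟩
    | add x x' _ _ hx hx' =>
      obtain ⟨b, hb⟩ := hx
      obtain ⟨b', hb'⟩ := hx'
      exact ⟨b + b', by rw [smul_add, hb, hb', add_smul]⟩
    | smul c x _ hx =>
      obtain ⟨b, hb⟩ := hx
      exact ⟨c * b, by rw [smul_comm, hb, mul_smul]⟩
  choose b hb using key
  have huniq : ∀ (x : L) (b' : S), U • x = b' • ℓ₀ → b' = b x := fun x b' hx => by
    have h0 : (b' - b x) • ℓ₀ = 0 := by rw [sub_smul, ← hx, ← hb x, sub_self]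
    exact sub_eq_zero.mp ((smul_eq_zero.mp h0).resolve_right hℓ₀)
  refine ⟨{ toFun := b
            map_add' := fun x x' => (huniq (x + x') (b x + b x')
              (by rw [smul_add, hb, hb, add_smul])).symm
            map_smul' := fun c x => (huniq (c • x) (c • b x)
              (by rw [smul_comm, hb, smul_eq_mul, mul_smul])).symm }, fun x x' hxx' => ?_⟩
  have h1 : U • x = U • x' := by
    change b x = b x' at hxx'
    rw [hb x, hb x', hxx']
  exact (smul_right_injective L hU0) h1

/-- **A finite torsion-free module which is cyclic at a prime is isomorphic to an ideal** of the
domain. [folklore] -/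
theorem exists_ideal_linearEquiv_of_forall_smul_eq_smul {S : Type u} [CommRing S] [IsDomain S]
    (Q : Ideal S) [Q.IsPrime] {L : Type v} [AddCommGroup L] [Module S L] [Module.Finite S L]
    [NoZeroSMulDivisors S L] {ℓ₀ : L} (hℓ₀ : ℓ₀ ≠ 0)
    (h : ∀ x : L, ∃ u ∉ Q, ∃ a : S, u • x = a • ℓ₀) :
    ∃ I : Ideal S, Nonempty (L ≃ₗ[S] I) := by
  obtain ⟨χ, hχ⟩ := exists_linearMap_injective_of_forall_smul_eq_smul Q hℓ₀ h
  exact ⟨LinearMap.range χ, ⟨LinearEquiv.ofInjective χ hχ⟩⟩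

end Literature.RingTheory.RegularLocalRing

end
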